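/- Copyright: the b2b-balaban cell (near-miss cell 7), T⁴-continuum fan-out, lineage t4-ne7b-formalise-leaf-02 (NE7b
CRUX team (2), leaf prover 02; gen 107 c950f60e48f91e1b, gen 108 re-base on IR-97-2 part 2 v1.4) — sanity companion
of the (A3) module J1 (`B16HistoryReprRead`, INTERFACE REQUEST NE7b IR-99-1); files ONLY if the owner's request names
it.  Released under the licence of the surrounding project. -/
import Summits.QuantumFields.BalabanUV.T4Continuum.Support.B16HistoryReprRead

/-!
# Sanity for (A3) module J1: the hypotheses of `histRead_tower_final` are JOINTLY INHABITED (non-vacuity) on a decided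
toy — a history-blind tower with step maps `× 1∕2` (the «small» choice) and `× 1∕3` on one-point configuration spaces,
`ρ₀ ≡ 1`, `B ≡ 1`, per-step envelopes `w = 1∕2, 1∕3`, the EMPTY reading (no region, no cube), unit factor values — and
`HistRead` for it is OBTAINED from the theorem (kernel-decided arithmetic; says NOTHING about Bałaban's objects); and
part 2's `holds` splits `ρ_2 = 25∕36` as `1∕4 + 4∕9` at this toy (a second decided instance of part 2's §8, at step
maps `< 1`).

HONEST.  [folklore]; nothing printed is asserted; BY-NAME EFFECT ON THE WALL: NONE; NE7b NOT PRINTED ∕ NOT PROVED; spine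
0∕9; rung (B)+1 finite T⁴ — NOT infinite volume, NOT the mass gap, NOT Clay.  HONEST DEPENDENCY (cell): continuum YM on T⁴ ⇐
BetaPertH ∧ nine spine estimates (0/9 proved); BetaPertH ⇐ (D1) ∧ (D4) ∧ CAP+tail; G-an2-4 gates asym, D1 and NE2/3/4.
-/

open Finset MeasureTheory
open Literature.MathematicalPhysics.QuantumFieldTheory.Balaban1983to89
open Summit.QuantumFields.BalabanUV.T4Continuum.HistoryGenealogyInstantiate

namespace Summit.QuantumFields.BalabanUV.T4Continuum.B16HistoryReprRead.Sanity

open Summit.QuantumFields.BalabanUV.T4Continuum.B16HistoryIndexedRepr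
open Summit.QuantumFields.BalabanUV.T4Continuum.B16HistoryReprChain
open Summit.QuantumFields.BalabanUV.T4Continuum.B16HistoryReprInstance
open Summit.QuantumFields.BalabanUV.T4Continuum.B16HistoryReprRead

noncomputable section

/-- toy step maps: `true ↦ × 1∕2` (the «small» choice), `false ↦ × 1∕3`, history-blind (part 2's `toyOp`). [folklore] -/
def halfOps (p : Bool) : RelLinPosHom (GoodClass.top Unit) (GoodClass.top Unit) :=
  if p then toyOp (1 / 2) (by norm_num) else toyOp (1 / 3) (by norm_num)

/-- the toy tower: both choices admissible after every history. [folklore] -/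
def halfT : Tower Bool (fun _ => Unit) (fun _ => GoodClass.top Unit) where
  branch _ _ := Finset.univ
  op _ _ p := halfOps p

/-- the same toy tower at every cutoff (one-point configuration spaces at every level of every run). [folklore] -/
def Tfam : (K : ℕ) → Tower Bool ((fun _ _ : ℕ => Unit) K) ((fun (_ _ : ℕ) => GoodClass.top Unit) K) := fun _ => halfT

/-- the small-field choice: `true` at every step of every run. [folklore] -/
def p₀ : ℕ → ℕ → Bool := fun _ _ => true

/-- the dressed initial densities: `ρ₀ ≡ 1`. [folklore] -/
def ρ₀ : (K : ℕ) → ℝ → ((fun _ _ : ℕ => Unit) K) 0 → ℝ := fun _ _ _ => 1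

/-- their sup: `B ≡ 1`. [folklore] -/
def B : ℕ → ℝ → ℝ := fun _ _ => 1

/-- per-step envelopes: the step factors themselves. [folklore] -/
def w : (K : ℕ) → (j : ℕ) → (Fin j → Bool) → Bool → ℝ := fun _ _ _ p => if p then 1 / 2 else 1 / 3

/-- THE EMPTY READING over the toy skeleton family (dimension `1`): no region, no cube; `L = 2`, `s ≡ 0`, `R ≡ Rm ≡ 1`.
[folklore] -/
def ℛ₀ : HistReading (skelFam Tfam p₀) 1 where
  L := 2
  s _ _ := 0
  R _ _ := 1
  Rm _ _ _ := 1
  N _ _ _ _ := ∅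
  cls _ _ _ _ := 0
  F _ _ _ _ := ∅

/-- the per-step envelopes hold (with equality). [folklore] -/
theorem hw_toy (K j : ℕ) (g : Fin j → Bool) (p : Bool) (x : Unit) :
    ((Tfam K).op j g p).T (fun _ => 1) x ≤ w K j g p := by
  show (halfOps p).T (fun _ => 1) x ≤ (if p then 1 / 2 else 1 / 3 : ℝ)
  cases p <;> simp [halfOps, toyOp]

/-- the envelopes are in `[0, 1]`, so their product along any history is at most `1`. [folklore] -/
theorem wAlong_toy_le_one (K : ℕ) (h : Fin K → Bool) : Tower.wAlong (w K) K h ≤ 1 := by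
  rw [wAlong_eq_prod]
  refine Finset.prod_le_one (fun j _ => ?_) fun j _ => ?_
  · show (0 : ℝ) ≤ if h j then 1 / 2 else 1 / 3
    split_ifs <;> norm_num
  · show (if h j then 1 / 2 else 1 / 3 : ℝ) ≤ 1
    split_ifs <;> norm_num

/-- **NON-VACUITY: `HistRead` FOR THE TOY FROM `histRead_tower_final`** — every hypothesis discharged by decided
arithmetic (`hw_toy`, `|1| ≤ 1`, the empty reading has no component so the per-history display reads `wAlong ≤ 1`,
the all-small history names no region by `rfl`). [folklore] -/
example : HistRead ℛ₀ (factorsOf Tfam p₀ B (fun _ _ _ _ => 1) (fun _ _ => 1) (fun _ _ => 1) (fun _ _ => le_rfl) w)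
    (reprFam Tfam p₀ ρ₀ (fun _ _ => trivial) (fun _ _ _ => zero_le_one) B (fun _ _ => zero_lt_one)) 1 0 :=
  histRead_tower_final Tfam p₀ ρ₀ (fun _ _ => trivial) (fun _ _ _ => zero_le_one) B (fun _ _ => zero_lt_one)
    (fun _ _ _ _ => 1) (fun _ _ => 1) (fun _ _ => 1) (fun _ _ => le_rfl) w ℛ₀
    (fun K j g p => by
      show (0 : ℝ) ≤ if p then 1 / 2 else 1 / 3
      split_ifs <;> norm_num)
    (fun K _ j g p x => hw_toy K j g p x)
    (fun K t _ _ y => by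
      show |(1 : ℝ)| ≤ 1
      rw [abs_one])
    (fun K t _ _ h _ => by
      rw [Finset.prod_eq_one fun j _ => by
        rw [(ℛ₀.runOf K true (h, (), ())).comp_histM_eq_empty_of_N (fun _ => rfl) j, Finset.prod_empty]]
      exact wAlong_toy_le_one K h)
    (fun _ _ _ => rfl)

/-- one step: `ρ_1 = 1∕2 + 1∕3 = 5∕6` ((0.2) recovered, part 1's `dens_succ_eq_apply`). [folklore] -/
theorem toy_dens_one (V : Unit) : halfT.dens (fun _ => (1 : ℝ)) 1 V = 5 / 6 := by
  rw [halfT.dens_succ_eq_apply (ρ₀ := fun _ => (1 : ℝ)) trivial 0 Finset.univ halfOps (fun _ _ => rfl)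
    (fun _ _ _ _ => rfl)]
  simp [halfOps, toyOp, Tower.dens_zero]
  norm_num

/-- two steps: `ρ_2 = (5∕6)² = 25∕36`. [folklore] -/
theorem toy_dens_two (V : Unit) : halfT.dens (fun _ => (1 : ℝ)) 2 V = 25 / 36 := by
  rw [halfT.dens_succ_eq_apply (ρ₀ := fun _ => (1 : ℝ)) trivial 1 Finset.univ halfOps (fun _ _ => rfl)
    (fun _ _ _ _ => rfl)]
  simp [halfOps, toyOp, toy_dens_one]
  norm_num

/-- the all-small history term (`true, true`) is `1∕2 · 1∕2 = 1∕4`. [folklore] -/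
theorem toy_eterm_small (V : Unit) : halfT.eterm (fun _ => (1 : ℝ)) 2 (hsmall (fun _ => true) 2) V = 1 / 4 := by
  simp [Tower.eterm, hsmall, Fin.init, halfT, halfOps, toyOp]
  norm_num

/-- **THE LARGE SUMMAND AT CUTOFF `2`** (`B := 1` here, but the computation goes through part 2's `holds`, which holds
for every `B > 0`): `25∕36 − 1∕4 = 4∕9`. [folklore] -/
example : (reprOf halfT (fun _ => true) 2 (ρ₀ := fun _ => (1 : ℝ)) trivial (fun _ => zero_le_one)
    zero_lt_one).term true () = 4 / 9 := by
  have h := holds halfT (fun _ => true) 2 (ρ₀ := fun _ => (1 : ℝ)) trivial (fun _ => zero_le_one) zero_lt_one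
    (fun _ _ => Finset.mem_univ _) ()
  have h4 : (reprOf halfT (fun _ => true) 2 (ρ₀ := fun _ => (1 : ℝ)) trivial (fun _ => zero_le_one)
      zero_lt_one).term false () = 1 / 4 := by
    rw [term_false, toy_eterm_small]
  have hs := Fintype.sum_bool fun a =>
    (reprOf halfT (fun _ => true) 2 (ρ₀ := fun _ => (1 : ℝ)) trivial (fun _ => zero_le_one) zero_lt_one).term a ()
  rw [← h, toy_dens_two] at hs
  linarith

end

end Summit.QuantumFields.BalabanUV.T4Continuum.B16HistoryReprRead.Sanity
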